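import Summits.Ventures.Crystal3D.Theorems.StickyWulffConstantNoReconstructionGainExactPrep
import Summits.Ventures.Crystal3D.Theorems.StickyWulffConstantGenericWallFloorSteering
import HarnessLib

/-!
# Cores are slaved to their off-lattice balls: no core extends past an off-lattice-free plane
# (line `replication-exactness`, structure toward the residual)

HONEST FRAMING. Part of the venture `Summits/Ventures/Crystal3D` (cell `crystal3d-full`), supports the
crux `NoReconstructionGain` (stmt-Ventures-19144, route `route-Ventures-StickyWulffConstant`), line
`replication-exactness` (lead wulff-p1 g17).  A STRUCTURAL consequence of EXACT₀ for cores (films every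
nonempty block of which is strictly over-attached, the hypothesis of `adhesion_of_core`), in EVERY
direction:

* `core_le_of_offLatticeFree_plane` — assume EXACT₀; let `X ⊇ P` be a unit packing with `P ⊆ Λ₀` whose
  film `X ∖ P` is a P-core, `e` ANY unit vector and `t` a level with `P` on the near side
  (`⟪p,e⟫ ≤ t`) such that no OFF-LATTICE film ball has `e`-height within `1` of `t`.  Then NO film ball
  lies beyond the plane: `⟪x, e⟫ ≤ t` for every `x ∈ X`.
  Proof: the part `U` beyond the plane would be a film on the rigid half-crystal `H(e,t)` (its sites are
  sites, its off-lattice balls are `≥ 1` beyond); every bond from `U` to the rest ends at a SITE on the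
  near side (an off-lattice endpoint would be within `1` of the plane), i.e. at a plug of `U`; so EXACT₀
  gives `cross(X∖U, U) ≤ X(H,U) ≤ D(U)`, contradicting strict over-attachment unless `U = ∅`.
* `core_height_le` — in particular (direction `ν`): every film ball of a P-core around the slab sample lies
  at most `1` above the highest off-lattice film ball, or at the top level `−R` of the sample if there is
  none higher: **the on-lattice part of a core is glued on by its off-lattice part.**

* `core_lateral_le` — likewise in a horizontal direction `e ⟂ ν` (Bessel, `inner_sq_add_inner_sq_le` of …Steering):
  every ball of a P-core has `⟪x,e⟫ ≤ max (m+1) ρ` if its off-lattice film balls have `⟪x,e⟫ ≤ m`.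

So the confinement of a core (the line's residual, v5) reduces to the confinement of its OFF-LATTICE
balls: laterally and vertically the rest follows within distance `1`.

WHAT THIS IS NOT: a bound on the off-lattice part itself; EXACT₀ is assumed; rung F-C1 not moved.
-/

noncomputable section

namespace Summit.Ventures.Crystal3D.Theorems

open Summit.Ventures.Crystal3D
open Literature.MathematicalPhysics.StatisticalMechanics (fccStacking isHaggSeq_const
  le_dist_of_mem_barlowStacking_ideal contactDeficiency orderedContacts)
open scoped InnerProductSpace
open Finset

/-- **No core extends past an off-lattice-free plane** (any direction). -/
theorem core_le_of_offLatticeFree_plane (hE : ExactZeroGain) {e : EuclideanSpace ℝ (Fin 3)}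
    (he : ‖e‖ = 1) (X P : Finset (EuclideanSpace ℝ (Fin 3)))
    (hX : ∀ p ∈ X, ∀ q ∈ X, p ≠ q → 1 ≤ dist p q)
    (hPΛ : ∀ p ∈ P, p ∈ fccStacking 1 (Real.sqrt (2 / 3)))
    (hcore : ∀ S, S ⊆ X \ P → S.Nonempty →
      contactDeficiency S < (((((X \ S) ×ˢ S).filter fun pq => dist pq.1 pq.2 = 1).card : ℕ) : ℝ))
    (t : ℝ) (hPt : ∀ p ∈ P, ⟪p, e⟫_ℝ ≤ t)
    (hoff : ∀ x ∈ X \ P, x ∉ fccStacking 1 (Real.sqrt (2 / 3)) → 1 ≤ |⟪x, e⟫_ℝ - t|) :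
    ∀ x ∈ X, ⟪x, e⟫_ℝ ≤ t := by
  classical
  -- the part beyond the plane
  set U := X.filter fun x => t < ⟪x, e⟫_ℝ with hU
  have hUX : U ⊆ X := Finset.filter_subset _ _
  have hmemU : ∀ x, x ∈ U ↔ x ∈ X ∧ t < ⟪x, e⟫_ℝ := fun x => by rw [hU, Finset.mem_filter]
  have hUF : U ⊆ X \ P := by
    intro x hx
    obtain ⟨hxX, hxt⟩ := (hmemU x).1 hx
    refine Finset.mem_sdiff.2 ⟨hxX, fun hxP => ?_⟩
    have := hPt x hxP; linarith
  have hhd : ∀ x y : EuclideanSpace ℝ (Fin 3), ⟪x, e⟫_ℝ - ⟪y, e⟫_ℝ ≤ dist x y := fun x y =>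
    (le_abs_self _).trans (abs_inner_sub_le_dist he x y)
  by_contra hcon
  push Not at hcon
  obtain ⟨x₀, hx₀, hx₀t⟩ := hcon
  have hUne : U.Nonempty := ⟨x₀, (hmemU x₀).2 ⟨hx₀, hx₀t⟩⟩
  -- `U` is a film on `H(e, t)`
  have hfilm : IsFilmOn e t U := by
    refine ⟨fun x hx y hy hne => hX x (hUX hx) y (hUX hy) hne, ?_⟩
    intro x hx z hz
    obtain ⟨hzΛ, hzt⟩ := hz
    have hxt := ((hmemU x).1 hx).2
    by_cases hxΛ : x ∈ fccStacking 1 (Real.sqrt (2 / 3))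
    · have hne : x ≠ z := by rintro rfl; linarith
      exact le_dist_of_mem_barlowStacking_ideal isHaggSeq_const one_pos fcc_height_sq hxΛ hzΛ hne
    · have h1 := hoff x (hUF hx) hxΛ
      rw [abs_of_pos (by linarith)] at h1
      linarith [hhd x z]
  have hEU := hE e he t U hfilm
  -- every bond from the rest into `U` ends at a site on the near side, i.e. at a plug
  have hcross : (((((X \ U) ×ˢ U).filter fun pq => dist pq.1 pq.2 = 1).card : ℕ) : ℝ) ≤
      plugCount e t U := by
    rw [card_cross_eq_sum, plugCount]; push_cast
    refine Finset.sum_le_sum fun x hx => ?_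
    exact_mod_cast card_filter_le_plugSet_ncard e t (X \ U) x fun y hy hd => by
      obtain ⟨hyX, hyU⟩ := Finset.mem_sdiff.1 hy
      have hyt : ⟪y, e⟫_ℝ ≤ t := by
        by_contra h; push Not at h; exact hyU ((hmemU y).2 ⟨hyX, h⟩)
      have hxt := ((hmemU x).1 hx).2
      refine ⟨?_, hyt⟩
      by_contra hyΛ
      have hyP : y ∉ P := fun hyP => hyΛ (hPΛ y hyP)
      have h1 := hoff y (Finset.mem_sdiff.2 ⟨hyX, hyP⟩) hyΛ
      rw [abs_of_nonpos (by linarith)] at h1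
      have := hhd x y
      rw [dist_comm, hd] at this
      linarith
  have hlt := hcore U hUF hUne
  linarith

/-- **A core rises at most `1` above its highest off-lattice ball** (or stays at the sample's top level):
for the slab sample `P_ρ(ν,R)` and a P-core, if every off-lattice film ball has height `≤ m` then every
film ball has height `≤ max (m + 1) (−R)`. -/
theorem core_height_le (hE : ExactZeroGain) {ν : EuclideanSpace ℝ (Fin 3)} (hν : ‖ν‖ = 1) {R ρ : ℝ}
    (X P : Finset (EuclideanSpace ℝ (Fin 3)))
    (hX : ∀ p ∈ X, ∀ q ∈ X, p ≠ q → 1 ≤ dist p q)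
    (hP : ∀ p, p ∈ P ↔ (p ∈ fccStacking 1 (Real.sqrt (2 / 3)) ∧ -(2 * R) ≤ ⟪p, ν⟫_ℝ ∧
      ⟪p, ν⟫_ℝ ≤ -R ∧ ‖p‖ ^ 2 - ⟪p, ν⟫_ℝ ^ 2 ≤ ρ ^ 2))
    (hcore : ∀ S, S ⊆ X \ P → S.Nonempty →
      contactDeficiency S < (((((X \ S) ×ˢ S).filter fun pq => dist pq.1 pq.2 = 1).card : ℕ) : ℝ))
    (m : ℝ) (hm : ∀ x ∈ X \ P, x ∉ fccStacking 1 (Real.sqrt (2 / 3)) → ⟪x, ν⟫_ℝ ≤ m) :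
    ∀ x ∈ X, ⟪x, ν⟫_ℝ ≤ max (m + 1) (-R) := by
  refine core_le_of_offLatticeFree_plane hE hν X P hX (fun p hp => ((hP p).1 hp).1) hcore
    (max (m + 1) (-R)) (fun p hp => ((hP p).1 hp).2.2.1.trans (le_max_right _ _)) ?_
  intro x hx hxΛ
  have h1 := hm x hx hxΛ
  have h2 : ⟪x, ν⟫_ℝ + 1 ≤ max (m + 1) (-R) := by
    have := le_max_left (m + 1) (-R); linarith
  rw [abs_of_nonpos (by linarith)]
  linarith

/-- **A core reaches laterally at most `1` beyond its outermost off-lattice ball** (or the disc's edge):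
for the slab sample `P_ρ(ν,R)` (`ρ ≥ 0`), a P-core, and a horizontal unit direction `e ⟂ ν`, if every
off-lattice film ball has `⟪x, e⟫ ≤ m` then every ball has `⟪x, e⟫ ≤ max (m + 1) ρ`. -/
theorem core_lateral_le (hE : ExactZeroGain) {ν e : EuclideanSpace ℝ (Fin 3)} (hν : ‖ν‖ = 1)
    (he : ‖e‖ = 1) (heν : ⟪e, ν⟫_ℝ = 0) {R ρ : ℝ} (hρ : 0 ≤ ρ)
    (X P : Finset (EuclideanSpace ℝ (Fin 3)))
    (hX : ∀ p ∈ X, ∀ q ∈ X, p ≠ q → 1 ≤ dist p q)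
    (hP : ∀ p, p ∈ P ↔ (p ∈ fccStacking 1 (Real.sqrt (2 / 3)) ∧ -(2 * R) ≤ ⟪p, ν⟫_ℝ ∧
      ⟪p, ν⟫_ℝ ≤ -R ∧ ‖p‖ ^ 2 - ⟪p, ν⟫_ℝ ^ 2 ≤ ρ ^ 2))
    (hcore : ∀ S, S ⊆ X \ P → S.Nonempty →
      contactDeficiency S < (((((X \ S) ×ˢ S).filter fun pq => dist pq.1 pq.2 = 1).card : ℕ) : ℝ))
    (m : ℝ) (hm : ∀ x ∈ X \ P, x ∉ fccStacking 1 (Real.sqrt (2 / 3)) → ⟪x, e⟫_ℝ ≤ m) :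
    ∀ x ∈ X, ⟪x, e⟫_ℝ ≤ max (m + 1) ρ := by
  refine core_le_of_offLatticeFree_plane hE he X P hX (fun p hp => ((hP p).1 hp).1) hcore
    (max (m + 1) ρ) (fun p hp => ?_) ?_
  · obtain ⟨-, -, -, hlat⟩ := (hP p).1 hp
    have hb := inner_sq_add_inner_sq_le p e ν he hν heν
    have h1 : ⟪p, e⟫_ℝ ^ 2 ≤ ρ ^ 2 := by linarith
    have h2 : ⟪p, e⟫_ℝ ≤ ρ := by
      have := abs_le_of_sq_le_sq' h1 hρ
      exact this.2
    exact h2.trans (le_max_right _ _)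
  · intro x hx hxΛ
    have h1 := hm x hx hxΛ
    have h2 : ⟪x, e⟫_ℝ + 1 ≤ max (m + 1) ρ := by
      have := le_max_left (m + 1) ρ; linarith
    rw [abs_of_nonpos (by linarith)]
    linarith

end Summit.Ventures.Crystal3D.Theorems

end
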